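import Literature.MathematicalPhysics.QuantumFieldTheory.Balaban1983to89.B1Eq324BenfattoSect5PerBoxAppD
import Literature.MathematicalPhysics.QuantumFieldTheory.Balaban1983to89.B1Eq324BenfattoSect5SlotMasses
import Literature.MathematicalPhysics.QuantumFieldTheory.Balaban1983to89.B1Eq324BenfattoSect5Eq535
import HarnessLib

/-!
# `Balaban1983to89.B1Eq324BenfattoSect5PerBoxAtPavement` — [BenfattoEtAl1978] §5 pp. 157–159: THE PER-BOX RELATION AT A TESSERA OF THE PAVEMENT,
# WITH EVERYTHING BUT THE DATUM DISCHARGED — the three classes `Ψ′₁, Ψ″₁, Ψ₂` instantiated, the masses bounded by the lattice sums of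
# `…Sect5SlotMasses`, the small-field side condition from the tessera size; output = the two inequalities the pavement chains consume

statement-level skeleton of published theorems with citation tags; proofs where landed; nothing here is a claim about the
Yang–Mills mass gap

WHY THIS MODULE (cell `pub-ymgap`, seat `dag-n08-c` gen 19, INTENT-5; node N08 [Balaban1985UV3]).  The pavement chains (`…Sect5PavementChain.lowerPavementChain`,
`…Sect5PavementChainUpper.upperPavementChainCond`) take per-box bounds as hypotheses: `e^{ℓ_□}·∫_{χ^□_b}e^{Ψ′₁+Ψ₂}dP̄_ξ ≤ ∫_{χ^□_b}e^{Ψ_□}dP̄_ξ` (lower) and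
`∫_{χ^□_b}e^{Ψ_□}dP̄_ξ ≤ e^{u_□}·∫_{χ^□_b}e^{Ψ′₁+Ψ₂}dP̄_ξ` (upper), for `P̄_ξ = P̂₀(·|ξ_Γ)`.  The sibling seat dag-n08-b's `…Sect5PerBoxAppD.perBox_condField_appD`
proves both (conjuncts 4 and 5) for ANY class family `T` with the identifications `hT0/hT1/hT2`, ANY mass bounds `M, M̃` and ANY `Γ ⊇ Γ₁(□)` disjoint from
`□′ ∪ Γ₂(□)`.  This file fixes what the chains fix — `T` := print's three classes of `□_m`, `M, M̃` := the `O(L^d)` lattice-sum bounds of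
`…Sect5SlotMasses.mass_le_card_mul` / `weightedMass_le_card_mul` (every tuple of the three classes lies in `□_m`), the small-field side condition from
`|□′∪Γ₂(□)| ≤ L^d` — and returns the two inequalities with the exponent `E(□) ∓ Err(□)` as CLOSED expressions in the datum, so that a consumer sets
`ℓ_k(□) := E − Err`, `u_k(□) := E + Err` in the chains and reads `Σ_□E(□)` with dag-n08-b's `…Sect5FreeStep.perBoxE_eq_sum_truncatedExp_sub`.

DICTIONARY.  As in `…Sect5PerBoxAppD` (its `let`s `K, ε, W, cχ, K₀, ε₃₁, δ₂₉, δ₃₁, E, Err` are restated verbatim with `T`, `M`, `M̃` instantiated);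
`Γ` stays a parameter with the three geometric hypotheses the chains discharge (`Γ = Γ₁(B)`: `frame1_subset_corridors`, `disjoint_corridors_shrink`;
`Γ = C ∪ Γ₁(B)`: `…PavementChainUpper.disjoint_union_corridors_shrink_of_far`).

WHAT IS PROVED (theorems only; no definition, no named fact, no `sorry`; axioms standard).
* `classes_subset_box` (every tuple of the three classes of `□_m` has all its tesserae in `□_m`), `mass_classes_le` / `weightedMass_classes_le` (the masses
  `M(□), M̃(□)` of the three classes are `≤ A·L^d·Σ_p#adm·K_p^{p−1}` resp. the `δ`-inflated analogue — `O(b^{2d})`, uniformly in the box and in `|I|`),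
  `card_shrink_mul_exp_le` (the small-field side condition of (5.19) from `L^d e^{−b²/4} ≤ 1/6`), ★★★ `perBox_at_pavement` — the LOWER and UPPER per-box
  inequalities at a tessera `□_m` of the standard pavement for the datum `(J ⊆ I, A, b)`, conditioning set `Γ ⊇ Γ₁(□_m)` disjoint from `□′∪Γ₂`, data `ξ`
  small on `Γ` at threshold `γb`, with `E(□_m)`, `Err(□_m)` closed expressions.

HONEST SCOPE / NOT HERE.  An instantiation of `perBox_condField_appD` (no new analysis); AS PROVED vs AS PRINTED exactly as recorded there; the sum over
the boxes, the identification of `Σ_□E(□)` and the ledger are the sequel (`…CollectErrors` (O1)/(O2)).  `BasicLemmaPrinted` stays OPEN; count-neutral for N08;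
nothing of [Balaban1985UV3] (41)/(47)/(5) is asserted; nothing about d = 4, the continuum, OS axioms, a mass gap or the Clay problem.
-/

noncomputable section

open MeasureTheory ProbabilityTheory Finset
open scoped BigOperators Nat

namespace Literature.MathematicalPhysics.QuantumFieldTheory.Balaban1983to89.B1Eq324BenfattoSect5PerBoxAtPavement

open _root_.MeasureTheory _root_.ProbabilityTheory
open Literature.Probability.LatticeModels (setPartitions ursellOf)
open Literature.MathematicalPhysics.QuantumFieldTheory
open Literature.MathematicalPhysics.QuantumFieldTheory.Balaban1983to89.B1Eq324BenfattoLemma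
open Literature.MathematicalPhysics.QuantumFieldTheory.Balaban1983to89.B1Eq324BenfattoSect5Boxes
open Literature.MathematicalPhysics.QuantumFieldTheory.Balaban1983to89.B1Eq324BenfattoSect5Eq511
open Literature.MathematicalPhysics.QuantumFieldTheory.Balaban1983to89.B1Eq324BenfattoSect5Eq524
open Literature.MathematicalPhysics.QuantumFieldTheory.Balaban1983to89.B1Eq324BenfattoSect5Eq534
open Literature.MathematicalPhysics.QuantumFieldTheory.Balaban1983to89.B1Eq324BenfattoSect5Eq515
open Literature.MathematicalPhysics.QuantumFieldTheory.Balaban1983to89.B1Eq324GaussianMomentLeaf (momentConst)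
open Literature.MathematicalPhysics.QuantumFieldTheory.Balaban1983to89.B1Eq324BenfattoSect5PerBoxAppD (perBox_condField_appD)
open Literature.MathematicalPhysics.QuantumFieldTheory.Balaban1983to89.B1Eq324BenfattoSect5SlotMasses (mass_le_card_mul weightedMass_le_card_mul)
open Literature.MathematicalPhysics.QuantumFieldTheory.Balaban1983to89.B1Eq324BenfattoSect5Eq535 (card_le_of_subset_box)

variable {d : ℕ}

section AtPavement

variable {α β : ℝ} {s D : ℕ} {κ : ℝ} {a : Coef d} {J I : Finset (B1Eq324BenfattoLemma.Site d)} {L w v : ℕ}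
  {m : B1Eq324BenfattoLemma.Site d} {A : ℝ}

/-- **Every tuple of the three classes of `□_m` lies in `□_m`**: `Ψ′₁`'s tuples in `Γ₄ ∪ Γ₃`, `Ψ″₁`'s in `□′ ∪ Γ₃`, `Ψ₂`'s in `Γ₁(□) ∪ Γ₂(□)` — all inside
the tessera (`v ≤ w`). [cite: BenfattoEtAl1978, (5.7) p.154, (5.23)–(5.27) p.157] -/
theorem classes_subset_box (hv : v ≤ w) (c : Fin 3) (p : ℕ) (Δ : Fin p → J)
    (hΔ : Δ ∈ (![fun p => tuplesIn J p (frame4 L w v m) ∪ crossT J p (frame4 L w v m) (frame3 L w v m),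
        fun p => (tuplesIn J p (core L w m) \ tuplesIn J p (frame4 L w v m)) ∪
          (crossT J p (core L w m) (frame3 L w v m) \ crossT J p (frame4 L w v m) (frame3 L w v m)),
        fun p => crossT J p (frame1 L w m) (frame2 L w m) ∪ tuplesIn J p (frame2 L w m)] :
          Fin 3 → (p : ℕ) → Finset (Fin p → J)) c p) (i : Fin p) :
    (Δ i : B1Eq324BenfattoLemma.Site d) ∈ box L m := by
  have hcore : core L w m ⊆ box L m := by
    rw [core]
    exact shrink_subset_box L m _
  have h3 : frame3 L w v m ⊆ box L m :=
    (frame3_subset_frame2 L hv m).trans (Finset.subset_union_left.trans (frame2_union_frame4_subset_box L w v m))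
  have h4 : frame4 L w v m ⊆ box L m := (frame4_subset_core L w v m).trans hcore
  have h1 : frame1 L w m ⊆ box L m := by
    rw [frame1]
    exact Finset.sdiff_subset
  have h2 : frame2 L w m ⊆ box L m := Finset.subset_union_left.trans (frame2_union_frame4_subset_box L w v m)
  fin_cases c
  · simp only at hΔ
    rcases Finset.mem_union.1 hΔ with h | h
    · exact h4 ((mem_tuplesIn.1 h) i)
    · rcases Finset.mem_union.1 ((mem_crossT.1 h).1 i) with h' | h'
      · exact h4 h'
      · exact h3 h'
  · simp only at hΔ
    rcases Finset.mem_union.1 hΔ with h | h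
    · exact hcore ((mem_tuplesIn.1 (Finset.mem_sdiff.1 h).1) i)
    · rcases Finset.mem_union.1 ((mem_crossT.1 (Finset.mem_sdiff.1 h).1).1 i) with h' | h'
      · exact hcore h'
      · exact h3 h'
  · simp only at hΔ
    rcases Finset.mem_union.1 hΔ with h | h
    · rcases Finset.mem_union.1 ((mem_crossT.1 h).1 i) with h' | h'
      · exact h1 h'
      · exact h2 h'
    · exact h2 ((mem_tuplesIn.1 h) i)

/-- **The masses of the three classes are `O(L^d)`**: `M(□) ≤ A·L^d·Σ_{p≤s}#adm(p,D)·K(ϰ/2p)^{p−1}` for each class (`…SlotMasses.mass_le_card_mul` anchored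
in `□_m`, `|□_m| = L^d`). [cite: BenfattoEtAl1978, (5.11) p.155, (5.29) p.157] -/
theorem mass_classes_le (hκ : 0 < κ) (hA0 : 0 ≤ A)
    (hA : ∀ (p : ℕ) (Δ : Fin p → B1Eq324BenfattoLemma.Site d) (n : Fin p → ℕ), |a p Δ n| ≤ A) (hv : v ≤ w) (c : Fin 3) :
    ∑ p ∈ Finset.Icc 1 s, ∑ Δ ∈ (![fun p => tuplesIn J p (frame4 L w v m) ∪ crossT J p (frame4 L w v m) (frame3 L w v m),
        fun p => (tuplesIn J p (core L w m) \ tuplesIn J p (frame4 L w v m)) ∪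
          (crossT J p (core L w m) (frame3 L w v m) \ crossT J p (frame4 L w v m) (frame3 L w v m)),
        fun p => crossT J p (frame1 L w m) (frame2 L w m) ∪ tuplesIn J p (frame2 L w m)] :
          Fin 3 → (p : ℕ) → Finset (Fin p → J)) c p, ∑ n ∈ admissible p D,
        |a p (fun i => (Δ i : B1Eq324BenfattoLemma.Site d)) n| *
          Real.exp (-(κ / 2) * connLength fun i => (Δ i : B1Eq324BenfattoLemma.Site d)) ≤
      A * (L : ℝ) ^ d * ∑ p ∈ Finset.Icc 1 s, ((admissible p D).card : ℝ) *
        ((2 / (1 - Real.exp (-(κ / 2 / (p : ℕ) / Real.sqrt d))) * Real.exp (κ / 2 / (p : ℕ) / Real.sqrt d)) ^ d) ^ (p - 1) := by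
  have h := mass_le_card_mul (s := s) (D := D) (Jr := J) hκ hA0 (fun p _ Δ _ n _ => hA p Δ n) _ (box L m)
    (fun p _ Δ hΔ i => classes_subset_box hv c p Δ hΔ i)
  refine h.trans ?_
  have hS : 0 ≤ ∑ p ∈ Finset.Icc 1 s, ((admissible p D).card : ℝ) *
      ((2 / (1 - Real.exp (-(κ / 2 / (p : ℕ) / Real.sqrt d))) * Real.exp (κ / 2 / (p : ℕ) / Real.sqrt d)) ^ d) ^ (p - 1) := by
    refine Finset.sum_nonneg fun p _ => mul_nonneg (Nat.cast_nonneg _) (pow_nonneg (pow_nonneg (mul_nonneg ?_ (Real.exp_pos _).le) _) _)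
    refine div_nonneg (by norm_num) ?_
    have : Real.exp (-(κ / 2 / (p : ℕ) / Real.sqrt d)) ≤ 1 := Real.exp_le_one_iff.mpr (by
      have : 0 ≤ κ / 2 / (p : ℕ) / Real.sqrt d := by positivity
      linarith)
    linarith
  have hcard : ((box L m).card : ℝ) ≤ (L : ℝ) ^ d := by exact_mod_cast card_le_of_subset_box (subset_rfl : box L m ⊆ box L m)
  exact mul_le_mul_of_nonneg_right (mul_le_mul_of_nonneg_left hcard hA0) hS

/-- **The `δ`-inflated masses of the three classes are `O(L^d)`**: `M̃(□) ≤ A·e^{(δ/2)D²d}·L^d·Σ_{p≤s}#adm(p,D)·K((ϰ−δD²√d)/2p)^{p−1}` for each class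
(`…SlotMasses.weightedMass_le_card_mul`, rate `ϰ/2 − (δ/2)D²√d > 0`). [cite: BenfattoEtAl1978, (5.29) p.157, Appendix D p.166] -/
theorem weightedMass_classes_le (hA0 : 0 ≤ A) {δ : ℝ} (hres : 0 < κ / 2 - δ / 2 * ((D : ℝ) ^ 2 * Real.sqrt d))
    (hA : ∀ (p : ℕ) (Δ : Fin p → B1Eq324BenfattoLemma.Site d) (n : Fin p → ℕ), |a p Δ n| ≤ A) (hv : v ≤ w) (c : Fin 3) :
    ∑ p ∈ Finset.Icc 1 s, ∑ Δ ∈ (![fun p => tuplesIn J p (frame4 L w v m) ∪ crossT J p (frame4 L w v m) (frame3 L w v m),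
        fun p => (tuplesIn J p (core L w m) \ tuplesIn J p (frame4 L w v m)) ∪
          (crossT J p (core L w m) (frame3 L w v m) \ crossT J p (frame4 L w v m) (frame3 L w v m)),
        fun p => crossT J p (frame1 L w m) (frame2 L w m) ∪ tuplesIn J p (frame2 L w m)] :
          Fin 3 → (p : ℕ) → Finset (Fin p → J)) c p, ∑ n ∈ admissible p D,
        |a p (fun i => (Δ i : B1Eq324BenfattoLemma.Site d)) n| *
          Real.exp (-(κ / 2) * connLength fun i => (Δ i : B1Eq324BenfattoLemma.Site d)) *
          Real.exp (δ / 2 * ((D : ℝ) ^ 2 * (Real.sqrt d * connLength (fun i => (Δ i : B1Eq324BenfattoLemma.Site d)) + d))) ≤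
      A * Real.exp (δ / 2 * ((D : ℝ) ^ 2 * d)) * (L : ℝ) ^ d * ∑ p ∈ Finset.Icc 1 s, ((admissible p D).card : ℝ) *
        ((2 / (1 - Real.exp (-((κ / 2 - δ / 2 * ((D : ℝ) ^ 2 * Real.sqrt d)) / (p : ℕ) / Real.sqrt d))) *
          Real.exp ((κ / 2 - δ / 2 * ((D : ℝ) ^ 2 * Real.sqrt d)) / (p : ℕ) / Real.sqrt d)) ^ d) ^ (p - 1) := by
  have h := weightedMass_le_card_mul (s := s) (D := D) (Jr := J) (ϰ := κ) hres hA0 (fun p _ Δ _ n _ => hA p Δ n) _ (box L m)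
    (fun p _ Δ hΔ i => classes_subset_box hv c p Δ hΔ i)
  refine h.trans ?_
  have hS : 0 ≤ ∑ p ∈ Finset.Icc 1 s, ((admissible p D).card : ℝ) *
      ((2 / (1 - Real.exp (-((κ / 2 - δ / 2 * ((D : ℝ) ^ 2 * Real.sqrt d)) / (p : ℕ) / Real.sqrt d))) *
        Real.exp ((κ / 2 - δ / 2 * ((D : ℝ) ^ 2 * Real.sqrt d)) / (p : ℕ) / Real.sqrt d)) ^ d) ^ (p - 1) := by
    refine Finset.sum_nonneg fun p _ => mul_nonneg (Nat.cast_nonneg _) (pow_nonneg (pow_nonneg (mul_nonneg ?_ (Real.exp_pos _).le) _) _)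
    refine div_nonneg (by norm_num) ?_
    have : Real.exp (-((κ / 2 - δ / 2 * ((D : ℝ) ^ 2 * Real.sqrt d)) / (p : ℕ) / Real.sqrt d)) ≤ 1 := Real.exp_le_one_iff.mpr (by
      have : 0 ≤ (κ / 2 - δ / 2 * ((D : ℝ) ^ 2 * Real.sqrt d)) / (p : ℕ) / Real.sqrt d := by
        have := hres.le
        positivity
      linarith)
    linarith
  have hcard : ((box L m).card : ℝ) ≤ (L : ℝ) ^ d := by exact_mod_cast card_le_of_subset_box (subset_rfl : box L m ⊆ box L m)
  exact mul_le_mul_of_nonneg_right (mul_le_mul_of_nonneg_left hcard (mul_nonneg hA0 (Real.exp_pos _).le)) hS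

/-- **The small-field side condition of (5.19) from the tessera size**: `|□′∪Γ₂(□)|·e^{−b²/4} ≤ L^d·e^{−b²/4}`, so `L^d e^{−b²/4} ≤ 1/6` suffices.
[cite: BenfattoEtAl1978, (5.19) p.156, Appendix C Lemma 2 p.165] -/
theorem card_shrink_mul_exp_le {b : ℝ} (hsmall : ((L : ℝ) ^ d) * Real.exp (-(b ^ 2 / 4)) ≤ 1 / 6) :
    ((shrink L m w).card : ℝ) * Real.exp (-(b ^ 2 / 4)) ≤ 1 / 6 := by
  have hcard : ((shrink L m w).card : ℝ) ≤ (L : ℝ) ^ d := by exact_mod_cast card_le_of_subset_box (shrink_subset_box L m w)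
  exact (mul_le_mul_of_nonneg_right hcard (Real.exp_pos _).le).trans hsmall

/-- **THE PER-BOX RELATION AT A TESSERA OF THE PAVEMENT, LOWER AND UPPER, WITH CLOSED EXPONENTS** — `…PerBoxAppD.perBox_condField_appD` at the three
classes of `□_m` (`Ψ′₁`: tuples in `Γ₄` or crossing `Γ₄|Γ₃`; `Ψ″₁`: the rest of `□′ ∪ Γ₃`; `Ψ₂`: tuples in `Γ₂` or crossing `Γ₁|Γ₂`), with the masses
`M(□), M̃(□)` REPLACED by their `O(L^d)` lattice-sum bounds (`mass_classes_le`, `weightedMass_classes_le`) and the (5.19) side condition by `L^d e^{−b²/4} ≤ 1/6`: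
for `α, β > 0` with `E z² ≤ ½`, `d ≥ 1`, `ϰ > 0`, `A` supported in `J ⊆ I` with the global bound `|A| ≤ A`, `v ≤ w`, `1 ≤ w`, `1 ≤ b`, `0 ≤ γ ≤ 1`,
`γ(1+2d/α²) ≤ ½`, a conditioning set `Γ ⊇ Γ₁(□_m)` disjoint from `□′ ∪ Γ₂(□_m)`, data `ξ` with `|ξ_c| ≤ γb(1+d(Δ_c,I))` on `Γ`, a propagator rate
`0 ≤ δ ≤ log((2d+α²)/2d)` with `ϰ/2 > (δ/2)D²√d`, and `t`:
`e^{E − Err}·∫_{χ^□_b}e^{Ψ′₁+Ψ₂}dP̂₀(·|ξ_Γ) ≤ ∫_{χ^□_b}e^{Ψ_□}dP̂₀(·|ξ_Γ) ≤ e^{E + Err}·∫_{χ^□_b}e^{Ψ′₁+Ψ₂}dP̂₀(·|ξ_Γ)`, where `E` is the free-cumulant number of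
`perBox_condField` (the colourings of `≤ t` slots using `Ψ″₁`, avoiding `Ψ₂`, under `P̂₀`) and `Err` its error with the masses so replaced — both CLOSED
expressions in `(s, D, d, ϰ, α, β, γ, b, L, w, v, t, A, δ, m)`.  A consumer sets `ℓ_k(□) := E − Err` / `u_k(□) := E + Err` in
`…PavementChain.lowerPavementChain` / `…PavementChainUpper.upperPavementChainCond`. [cite: BenfattoEtAl1978, (5.29)–(5.33) pp.157–159, (5.36) p.159] -/
theorem perBox_at_pavement (hα : 0 < α) (hβ : 0 < β) (hvar : freeCov d α β 0 0 ≤ 1 / 2) (hd : 0 < d)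
    (hκ : 0 < κ) (hJ : CoefSupportedIn a J) (hJI : J ⊆ I) (hA0 : 0 ≤ A)
    (hA : ∀ (p : ℕ) (Δ : Fin p → B1Eq324BenfattoLemma.Site d) (n : Fin p → ℕ), |a p Δ n| ≤ A)
    (hv : v ≤ w) (hw : 1 ≤ w) {b γ : ℝ} (hb : 1 ≤ b) (hγ0 : 0 ≤ γ) (hγ1 : γ ≤ 1) (hγ : γ * (1 + 2 * d / α ^ 2) ≤ 1 / 2)
    {Γ : Finset (B1Eq324BenfattoLemma.Site d)} (hΓ : frame1 L w m ⊆ Γ) (hΓd : Disjoint Γ (shrink L m w))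
    {ξ : B1Eq324BenfattoLemma.Site d → ℝ} (hξ : ξ ∈ smallFieldOn (Γ : Set (B1Eq324BenfattoLemma.Site d)) I (γ * b))
    (hsmall : ((L : ℝ) ^ d) * Real.exp (-(b ^ 2 / 4)) ≤ 1 / 6)
    {δ : ℝ} (hδ0 : 0 ≤ δ) (hδle : δ ≤ Real.log ((2 * d + α ^ 2) / (2 * d))) (hres : 0 < κ / 2 - δ / 2 * ((D : ℝ) ^ 2 * Real.sqrt d))
    (t : ℕ) :
    let T : Fin 3 → (p : ℕ) → Finset (Fin p → J) :=
      ![fun p => tuplesIn J p (frame4 L w v m) ∪ crossT J p (frame4 L w v m) (frame3 L w v m),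
        fun p => (tuplesIn J p (core L w m) \ tuplesIn J p (frame4 L w v m)) ∪
          (crossT J p (core L w m) (frame3 L w v m) \ crossT J p (frame4 L w v m) (frame3 L w v m)),
        fun p => crossT J p (frame1 L w m) (frame2 L w m) ∪ tuplesIn J p (frame2 L w m)]
    let M : ℝ := A * (L : ℝ) ^ d * ∑ p ∈ Finset.Icc 1 s, ((admissible p D).card : ℝ) *
        ((2 / (1 - Real.exp (-(κ / 2 / (p : ℕ) / Real.sqrt d))) * Real.exp (κ / 2 / (p : ℕ) / Real.sqrt d)) ^ d) ^ (p - 1)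
    let Mt : ℝ := A * Real.exp (δ / 2 * ((D : ℝ) ^ 2 * d)) * (L : ℝ) ^ d * ∑ p ∈ Finset.Icc 1 s, ((admissible p D).card : ℝ) *
        ((2 / (1 - Real.exp (-((κ / 2 - δ / 2 * ((D : ℝ) ^ 2 * Real.sqrt d)) / (p : ℕ) / Real.sqrt d))) *
          Real.exp ((κ / 2 - δ / 2 * ((D : ℝ) ^ 2 * Real.sqrt d)) / (p : ℕ) / Real.sqrt d)) ^ d) ^ (p - 1)
    let K : ℝ := 4 * (s1Const s D d κ * A * b ^ D * (L : ℝ) ^ d)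
    let ε : ℝ := s1Const s D d κ * A * b ^ D * Real.exp (-(κ / 4 * v)) * (L : ℝ) ^ d
    let W : ℝ := 3 * (((shrink L m w).card : ℝ) * Real.exp (-(b ^ 2 / 4)))
    let cχ : ℕ → ℝ := fun k => 2 ^ k * ((∑ π ∈ setPartitions (univ : Finset (Fin k)), ((π.card - 1)! : ℝ)) *
        ((min 1 (2 * ((shrink L m w).card : ℝ) * Real.exp (-(b ^ 2 / 4)))) ^ ((2 * k : ℕ) : ℝ)⁻¹ *
          ((1 + (1 + 2 * d / α ^ 2) * (γ * b)) ^ D * M * momentConst D (2 * k) (freeCov d α β 0 0).toNNReal) ^ k))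
    let K₀ : ℝ := max (max 1 (freeCov d α β 0 0)) ((1 + 2 * d / α ^ 2) * (γ * b))
    let ε₃₁ : ℝ := max (β * (2 * d * (freeCov d α β 0 0 * (2 * d / (2 * d + α ^ 2)) ^ (w - v))) *
          (γ * b * ∑ c ∈ frame1 L w m, (1 + distToRegion I c)))
        (2 * d * freeCov d α β 0 0 * (2 * d / (2 * d + α ^ 2)) ^ (w - v) / α ^ 2)
    let δ₂₉ : ℕ → ℝ := fun k => 2 ^ (k * D) * 2 ^ 2 ^ (k * D) * K₀ ^ (k * D) * Real.exp (-(δ / 2 * ((v : ℝ) + 1))) * Mt ^ k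
    let δ₃₁ : ℕ → ℝ := fun k => M ^ k * (2 ^ (k * D) * 2 ^ 2 ^ (k * D) * ((k * D : ℕ) * K₀ ^ (k * D) * ε₃₁))
    let lhs : ℝ := ∫ z in smallFieldOn (shrink L m w : Set (B1Eq324BenfattoLemma.Site d)) I b,
          Real.exp (psiBox s D κ a L w m z) ∂condField d α β Γ ξ
    let rhs : ℝ := ∫ z in smallFieldOn (shrink L m w : Set (B1Eq324BenfattoLemma.Site d)) I b,
          Real.exp (psi1p s D κ a L w v m z + psi2 s D κ a L w m z) ∂condField d α β Γ ξ
    let E : ℝ := ∑ k ∈ Finset.range t,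
            (∑ f ∈ univ.filter (fun f : Fin (k + 1) → Fin 3 => (∃ j, f j = 1) ∧ ∀ j, f j ≠ 2),
              ursellOf (fun P : Finset (Fin (k + 1)) => ∫ z, ∏ j ∈ P,
                (∑ p ∈ Finset.Icc 1 s, ∑ Δ ∈ T (f j) p, ∑ n ∈ admissible p D, term κ a z p Δ n) ∂P0 d α β) univ)
              / (k + 1)!
    let Err : ℝ := 2 * (2 ^ ((t + 1).choose 2) * K ^ (t + 1) / (t + 1)!) + Real.exp (2 * K) * W
        + ∑ k ∈ Finset.range t,
            (3 ^ (k + 1) * ((∑ π ∈ setPartitions (univ : Finset (Fin (k + 1))), ((π.card - 1)! : ℝ)) * (ε * K ^ k))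
              + 3 ^ (k + 1) * (cχ (k + 1) + δ₂₉ (k + 1)) + 3 ^ (k + 1) * (cχ (k + 1) + δ₃₁ (k + 1))) / (k + 1)!
    Real.exp (E - Err) * rhs ≤ lhs ∧ lhs ≤ Real.exp (E + Err) * rhs := by
  intro T M Mt
  have hξ' : ∀ c ∈ Γ, |ξ c| ≤ γ * b * (1 + distToRegion I c) := fun c hc => hξ c (Finset.mem_coe.2 hc)
  have hT0 : ∀ p, T 0 p = tuplesIn J p (frame4 L w v m) ∪ crossT J p (frame4 L w v m) (frame3 L w v m) := fun p => rfl
  have hT1 : ∀ p, T 1 p = (tuplesIn J p (core L w m) \ tuplesIn J p (frame4 L w v m)) ∪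
      (crossT J p (core L w m) (frame3 L w v m) \ crossT J p (frame4 L w v m) (frame3 L w v m)) := fun p => rfl
  have hT2 : ∀ p, T 2 p = crossT J p (frame1 L w m) (frame2 L w m) ∪ tuplesIn J p (frame2 L w m) := fun p => rfl
  have hM : ∀ c, ∑ p ∈ Finset.Icc 1 s, ∑ Δ ∈ T c p, ∑ n ∈ admissible p D,
      |a p (fun i => (Δ i : B1Eq324BenfattoLemma.Site d)) n| *
        Real.exp (-(κ / 2) * connLength fun i => (Δ i : B1Eq324BenfattoLemma.Site d)) ≤ M :=
    fun c => mass_classes_le hκ hA0 hA hv c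
  have hMt : ∀ c, ∑ p ∈ Finset.Icc 1 s, ∑ Δ ∈ T c p, ∑ n ∈ admissible p D,
      |a p (fun i => (Δ i : B1Eq324BenfattoLemma.Site d)) n| *
        Real.exp (-(κ / 2) * connLength fun i => (Δ i : B1Eq324BenfattoLemma.Site d)) *
        Real.exp (δ / 2 * ((D : ℝ) ^ 2 * (Real.sqrt d * connLength (fun i => (Δ i : B1Eq324BenfattoLemma.Site d)) + d))) ≤ Mt :=
    fun c => weightedMass_classes_le hA0 hres hA hv c
  have h := perBox_condField_appD (s := s) (D := D) hα hβ hvar hd hκ hJ hJI hA0 hA hv hw hb hγ0 hγ1 hγ hΓ hΓd hξ'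
    (card_shrink_mul_exp_le hsmall) T hT0 hT1 hT2 hM hδ0 hδle hMt t
  exact ⟨h.2.2.2.1, h.2.2.2.2⟩

end AtPavement

end Literature.MathematicalPhysics.QuantumFieldTheory.Balaban1983to89.B1Eq324BenfattoSect5PerBoxAtPavement

end
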